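import Summits.CriticalPhenomena.CardyFormulaZ2.Theses.CardyIKTransport

/-!
# Negative-side facts about `IKMixedBoxCrossing` (crux stmt-CriticalPhenomena-5911)

Support lemmas from the standing disprover (refuter, cdisprove lane). Nothing here asserts the crux
or any Theses decl positively.

* `iff_named` — the crux restated over NAMED pieces of its explicit i.i.d.-bit gauge (`μIK`,
  `parSet`, `blackSet`, `antiSet`, `edges`, `hEvent`/`vEvent`, `pH`/`pV`); provers may import these.
* `iKMixedBoxCrossing_false_without_n_pos` — the side condition `1 ≤ n` is load-bearing (`n = 0`
  empties the source side).
* `pH_one_zero_zero : pH S 1 0 0 = 1/4` for every `S` (two adjacent cells both black; pair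
  correlations vanish), hence `c_le_quarter` (every admissible constant is `≤ 1/4`) and
  `not_IKMixedBoxCrossing_with_large_constant`.
* (sequel file `IKMixedBoxCrossingNoFKG`: Harris–FKG fails for the colour field.)
-/

namespace Summit.CriticalPhenomena.CardyFormulaZ2.Theorems.IKMixedBoxCrossing.Negative

open scoped Classical ENNReal
open MeasureTheory ProbabilityTheory unitInterval
open Literature.Probability.Percolation Literature.Probability.LatticeModels
open Summit.CriticalPhenomena.CardyFormulaZ2.Theses.CardyIKTransport (IKMixedBoxCrossing)

noncomputable section

/-! ## §1 The explicit gauge, named -/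

/-- Bit space of the gauge: column signs `A ⊆ ℤ` × row signs `B ⊆ ℤ` × biased plaquettes ×
fair plaquettes × diagonal coins. -/
abbrev Ω : Type := Set ℤ × (Set ℤ × (Set (Site 2) × (Set (Site 2) × Set (Site 2))))

/-- The gauge measure (independent of the column pattern `S`). -/
def μIK : Measure Ω :=
  (sitePercolation ℤ half).prod ((sitePercolation ℤ half).prod
    ((sitePercolation (Site 2) (Set.projIcc (0:ℝ) 1 zero_le_one (2 * Real.sqrt 3 - 3))).prod
      ((sitePercolation (Site 2) half).prod (sitePercolation (Site 2) half))))

/-- Plaquette defects: the face with lower-left cell `f` reads the biased field on `S`-columns and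
the fair field elsewhere. -/
def parSet (S : Set ℤ) (ω : Ω) : Set (Site 2) :=
  {f | (f 0 ∈ S ∧ f ∈ ω.2.2.1) ∨ (f 0 ∉ S ∧ f ∈ ω.2.2.2.1)}

/-- Black cells: column sign ⊕ row sign ⊕ parity of the defects in the rectangle between `0` and `v`. -/
def blackSet (S : Set ℤ) (ω : Ω) : Set (Site 2) :=
  {v | Xor (v 0 ∈ ω.1) (Xor (v 1 ∈ ω.2.1) (Odd ((Finset.filter (fun f : ℤ × ℤ => ![f.1, f.2] ∈ parSet S ω)
    (Finset.Ico (min 0 (v 0)) (max 0 (v 0)) ×ˢ Finset.Ico (min 0 (v 1)) (max 0 (v 1)))).card)))}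

/-- Faces carrying the ANTI-diagonal: forced off `S`, a fair coin on `S`. -/
def antiSet (S : Set ℤ) (ω : Ω) : Set (Site 2) := {f | f 0 ∉ S ∨ f ∈ ω.2.2.2.2}

/-- Open edges: nearest-neighbour and chosen-diagonal pairs of black cells. -/
def edges (S : Set ℤ) (ω : Ω) : BondConfig (Site 2) :=
  {e | ∃ u v, e = s(u, v) ∧ u ∈ blackSet S ω ∧ v ∈ blackSet S ω ∧ (v = u + ![1, 0] ∨ v = u + ![0, 1] ∨
    (v = u + ![1, 1] ∧ u ∉ antiSet S ω) ∨ (v = u + ![1, -1] ∧ (u + ![0, -1]) ∈ antiSet S ω))}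

/-- Black left–right crossing EVENT of the `2n × n` box at `(a, b)`. -/
def hEvent (S : Set ℤ) (n : ℕ) (a b : ℤ) : Set Ω :=
  {ω | edges S ω ∈ openCrossing {v | a ≤ v 0 ∧ v 0 < a + 2 * n ∧ b ≤ v 1 ∧ v 1 < b + n}
    {v | v 0 = a ∧ b ≤ v 1 ∧ v 1 < b + n} {v | v 0 = a + 2 * n - 1 ∧ b ≤ v 1 ∧ v 1 < b + n}}

/-- Black bottom–top crossing EVENT of the `n × 2n` box at `(a, b)`. -/
def vEvent (S : Set ℤ) (n : ℕ) (a b : ℤ) : Set Ω :=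
  {ω | edges S ω ∈ openCrossing {v | a ≤ v 0 ∧ v 0 < a + n ∧ b ≤ v 1 ∧ v 1 < b + 2 * n}
    {v | v 1 = b ∧ a ≤ v 0 ∧ v 0 < a + n} {v | v 1 = b + 2 * n - 1 ∧ a ≤ v 0 ∧ v 0 < a + n}}

/-- Black left–right crossing probability of the `2n × n` box at `(a, b)`. -/
def pH (S : Set ℤ) (n : ℕ) (a b : ℤ) : ℝ := μIK.real (hEvent S n a b)

/-- Black bottom–top crossing probability of the `n × 2n` box at `(a, b)`. -/
def pV (S : Set ℤ) (n : ℕ) (a b : ℤ) : ℝ := μIK.real (vEvent S n a b)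

/-- The crux, verbatim, over the named pieces (definitional unfolding only). -/
theorem iff_named :
    IKMixedBoxCrossing ↔ ∃ c : ℝ, 0 < c ∧ ∀ S : Set ℤ, ∀ n : ℕ, 1 ≤ n → ∀ a b : ℤ,
      c ≤ pH S n a b ∧ c ≤ pV S n a b := by
  -- unfold the names and zeta/beta-reduce the thesis' `let`s; `simp only` then closes by `Iff.rfl`
  simp only [IKMixedBoxCrossing, pH, pV, hEvent, vEvent, edges, blackSet, antiSet, parSet, μIK, Set.mem_setOf_eq]

/-! ## §2 Load-bearing hypothesis `1 ≤ n` -/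

/-- A set with no element has `μIK.real`-mass `0` (bookkeeping). -/
theorem real_eq_zero_of_forall_notMem {s : Set Ω} (hs : ∀ ω, ω ∉ s) : μIK.real s = 0 := by
  rw [Set.eq_empty_of_forall_notMem hs]; simp

/-- For `n = 0` the source side of the `2n × n` box is empty, so the crossing event is empty. -/
theorem pH_zero (S : Set ℤ) (a b : ℤ) : pH S 0 a b = 0 := by
  unfold pH hEvent
  apply real_eq_zero_of_forall_notMem
  intro ω hω
  simp only [Set.mem_setOf_eq, mem_openCrossing_iff] at hω
  obtain ⟨x, ⟨-, hb, hlt⟩, -⟩ := hω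
  push_cast at hlt
  omega

/-- Likewise for the `n × 2n` box. -/
theorem pV_zero (S : Set ℤ) (a b : ℤ) : pV S 0 a b = 0 := by
  unfold pV vEvent
  apply real_eq_zero_of_forall_notMem
  intro ω hω
  simp only [Set.mem_setOf_eq, mem_openCrossing_iff] at hω
  obtain ⟨x, ⟨-, ha, hlt⟩, -⟩ := hω
  push_cast at hlt
  omega

/-- Any proof must use `1 ≤ n`: the crux with that side condition dropped is false (witness `n = 0`). -/
theorem iKMixedBoxCrossing_false_without_n_pos :
    ¬ (∃ c : ℝ, 0 < c ∧ ∀ S : Set ℤ, ∀ n : ℕ, ∀ a b : ℤ, c ≤ pH S n a b ∧ c ≤ pV S n a b) := by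
  rintro ⟨c, hc, h⟩
  have h0 := (h ∅ 0 0 0).1
  rw [pH_zero] at h0
  exact absurd h0 (not_le.mpr hc)

/-! ## §3 Tightness of the constant: the `n = 1` boxes have crossing probability exactly `1/4`

The colour field is pairwise independent (pair correlations vanish), so two adjacent cells are both
black with probability `1/4`; for `n = 1` the long-way crossing of the `2 × 1` box IS that event.
Hence every admissible constant satisfies `c ≤ 1/4` (`c_le_quarter`). The computation also certifies
that the interface is non-junk: `μIK` is a genuine product probability measure and the crossing
event is a non-trivial cylinder. -/

/-- The four hidden factors of the gauge (everything but the column signs `A`). -/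
abbrev Rest : Type := Set ℤ × (Set (Site 2) × (Set (Site 2) × Set (Site 2)))

/-- Their joint law. -/
def ν : Measure Rest :=
  (sitePercolation ℤ half).prod
    ((sitePercolation (Site 2) (Set.projIcc (0:ℝ) 1 zero_le_one (2 * Real.sqrt 3 - 3))).prod
      ((sitePercolation (Site 2) half).prod (sitePercolation (Site 2) half)))

/-- The gauge measure factors as (column signs) ⊗ (the other four bit fields). [folklore] -/
theorem μIK_eq : μIK = (sitePercolation ℤ half).prod ν := rfl

/-- Probability-measure instance for a product of Bernoulli product measures. [folklore] -/
instance : IsProbabilityMeasure ν := by unfold ν; infer_instance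
/-- Probability-measure instance for a product of Bernoulli product measures. [folklore] -/
instance : IsProbabilityMeasure μIK := by unfold μIK; infer_instance

/-- `σ ½ = ½` in the unit interval. [folklore] -/
theorem symm_half : σ half = half := by
  apply Subtype.ext; rw [coe_symm_eq, coe_half]; norm_num

/-- The Bernoulli(1/2) factor of `setBer(univ, half)` gives mass `1/2` to `{q | q}` … -/
theorem factor_true (i : ℤ) :
    (toNNReal half • Measure.dirac (i ∈ (Set.univ : Set ℤ)) + toNNReal (σ half) • Measure.dirac False)
      {q : Prop | q} = toNNReal half := by
  simp [Set.indicator]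

/-- … and mass `1/2` to `{q | ¬ q}`. -/
theorem factor_false (i : ℤ) :
    (toNNReal half • Measure.dirac (i ∈ (Set.univ : Set ℤ)) + toNNReal (σ half) • Measure.dirac False)
      {q : Prop | ¬ q} = toNNReal half := by
  simp [Set.indicator, symm_half]

/-- Fair column signs: `P(0 ∈ A ∧ 1 ∈ A) = ¼` (as `toNNReal ½ ²`). [folklore] -/
theorem μA_mem_mem : sitePercolation ℤ half {A : Set ℤ | 0 ∈ A ∧ 1 ∈ A} = toNNReal half * toNNReal half := by
  rw [sitePercolation, setBernoulli_apply']
  have : (fun p : ℤ → Prop ↦ {i | p i}) ⁻¹' {A : Set ℤ | 0 ∈ A ∧ 1 ∈ A}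
      = Set.pi (({0, 1} : Finset ℤ) : Set ℤ) (fun _ => {q : Prop | q}) := by
    ext f; simp
  rw [this, Measure.infinitePi_pi _ (fun _ _ => MeasurableSpace.measurableSet_top),
    Finset.prod_pair (by norm_num), factor_true, factor_true]

/-- Fair column signs: `P(0 ∉ A ∧ 1 ∉ A) = ¼`. [folklore] -/
theorem μA_not_not : sitePercolation ℤ half {A : Set ℤ | 0 ∉ A ∧ 1 ∉ A} = toNNReal half * toNNReal half := by
  rw [sitePercolation, setBernoulli_apply']
  have : (fun p : ℤ → Prop ↦ {i | p i}) ⁻¹' {A : Set ℤ | 0 ∉ A ∧ 1 ∉ A}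
      = Set.pi (({0, 1} : Finset ℤ) : Set ℤ) (fun _ => {q : Prop | ¬ q}) := by
    ext f; simp
  rw [this, Measure.infinitePi_pi _ (fun _ _ => MeasurableSpace.measurableSet_top),
    Finset.prod_pair (by norm_num), factor_false, factor_false]

/-- Fair column signs: `P(0 ∈ A) = ½`. [folklore] -/
theorem μA_mem : sitePercolation ℤ half {A : Set ℤ | 0 ∈ A} = toNNReal half := by
  rw [sitePercolation, setBernoulli_apply']
  have : (fun p : ℤ → Prop ↦ {i | p i}) ⁻¹' {A : Set ℤ | 0 ∈ A}
      = Set.pi (({0} : Finset ℤ) : Set ℤ) (fun _ => {q : Prop | q}) := by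
    ext f; simp
  rw [this, Measure.infinitePi_pi _ (fun _ _ => MeasurableSpace.measurableSet_top),
    Finset.prod_singleton, factor_true]

/-- Fair column signs: `P(0 ∉ A) = ½`. [folklore] -/
theorem μA_not : sitePercolation ℤ half {A : Set ℤ | 0 ∉ A} = toNNReal half := by
  rw [sitePercolation, setBernoulli_apply']
  have : (fun p : ℤ → Prop ↦ {i | p i}) ⁻¹' {A : Set ℤ | 0 ∉ A}
      = Set.pi (({0} : Finset ℤ) : Set ℤ) (fun _ => {q : Prop | ¬ q}) := by
    ext f; simp
  rw [this, Measure.infinitePi_pi _ (fun _ _ => MeasurableSpace.measurableSet_top),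
    Finset.prod_singleton, factor_false]

/-- Hidden bits: `P(0 ∈ B) = ½`. [folklore] -/
theorem ν_fst_mem : ν {y : Rest | 0 ∈ y.1} = toNNReal half := by
  have : {y : Rest | 0 ∈ y.1} = {B : Set ℤ | 0 ∈ B} ×ˢ Set.univ := by ext; simp
  rw [this, ν, Measure.prod_prod, μA_mem, measure_univ, mul_one]

/-- Hidden bits: `P(0 ∉ B) = ½`. [folklore] -/
theorem ν_fst_not : ν {y : Rest | 0 ∉ y.1} = toNNReal half := by
  have : {y : Rest | 0 ∉ y.1} = {B : Set ℤ | 0 ∉ B} ×ˢ Set.univ := by ext; simp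
  rw [this, ν, Measure.prod_prod, μA_not, measure_univ, mul_one]

/-- The `n = 1` horizontal event in bit form: cells `(0,0)` and `(1,0)` both black, i.e.
`A₀ ⊕ B₀` and `A₁ ⊕ B₀`. -/
def F : Set Ω := {ω | Xor (0 ∈ ω.1) (0 ∈ ω.2.1) ∧ Xor (1 ∈ ω.1) (0 ∈ ω.2.1)}

/-- The `n = 1` event as a disjoint union of two product cylinders. [folklore] -/
theorem F_eq : F = ({A : Set ℤ | 0 ∉ A ∧ 1 ∉ A} ×ˢ {y : Rest | 0 ∈ y.1}) ∪
    ({A : Set ℤ | 0 ∈ A ∧ 1 ∈ A} ×ˢ {y : Rest | 0 ∉ y.1}) := by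
  ext ω
  simp only [F, Xor, Set.mem_setOf_eq, Set.mem_union, Set.mem_prod]
  tauto

/-- Gauge mass of the `n = 1` event in `ℝ≥0∞`: `2 · (½)³`. [folklore] -/
theorem μIK_F : μIK F = 2 * ((toNNReal half : ℝ≥0∞) * toNNReal half * toNNReal half) := by
  rw [F_eq, measure_union, μIK_eq, Measure.prod_prod, Measure.prod_prod, μA_not_not, μA_mem_mem,
    ν_fst_mem, ν_fst_not]
  · ring
  · rw [Set.disjoint_left]
    rintro ⟨A, y⟩ ⟨⟨h0, -⟩, -⟩ ⟨⟨h0', -⟩, -⟩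
    exact h0 h0'
  · exact ((measurableSet_mem 0).inter (measurableSet_mem 1)).prod
      (measurable_fst (measurableSet_notMem 0))

/-- Gauge probability of the `n = 1` event: `1/4`. [folklore] -/
theorem μIK_real_F : μIK.real F = 1 / 4 := by
  rw [Measure.real, μIK_F]
  have h : ((toNNReal half : ℝ≥0∞)).toReal = 1 / 2 := by
    rw [ENNReal.coe_toReal, coe_toNNReal, coe_half]
  rw [ENNReal.toReal_mul, ENNReal.toReal_mul, ENNReal.toReal_mul, h]
  norm_num

/-- Colour of the cell `(0,0)` in bits: `A₀ ⊕ B₀` (empty defect rectangle). [folklore] -/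
theorem blk_zero_zero (S : Set ℤ) (ω : Ω) : ![0, 0] ∈ blackSet S ω ↔ Xor (0 ∈ ω.1) (0 ∈ ω.2.1) := by
  simp [blackSet, Xor]

/-- Colour of the cell `(1,0)` in bits: `A₁ ⊕ B₀` (empty defect rectangle). [folklore] -/
theorem blk_one_zero (S : Set ℤ) (ω : Ω) : ![1, 0] ∈ blackSet S ω ↔ Xor (1 ∈ ω.1) (0 ∈ ω.2.1) := by
  simp [blackSet, Xor]

/-- A site with coordinates `(0,0)` is `![0,0]`. [folklore] -/
theorem vec_eq_zero_zero {x : Site 2} (h0 : x 0 = 0) (h1 : x 1 = 0) : x = ![0, 0] := by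
  ext i; fin_cases i <;> simp [h0, h1]

/-- A site with coordinates `(1,0)` is `![1,0]`. [folklore] -/
theorem vec_eq_one_zero {x : Site 2} (h0 : x 0 = 1) (h1 : x 1 = 0) : x = ![1, 0] := by
  ext i; fin_cases i <;> simp [h0, h1]

/-- EVENT IDENTIFICATION at `n = 1`: the `2 × 1` box `{(0,0), (1,0)}` is crossed iff both cells are
black (the only available edge is the horizontal bond; `openConnIn` keeps the path inside the box). -/
theorem hEvent_one (S : Set ℤ) : hEvent S 1 0 0 = F := by
  ext ω
  simp only [hEvent, F, Set.mem_setOf_eq, mem_openCrossing_iff, openConnIn]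
  constructor
  · rintro ⟨x, ⟨hx0, hx1, hx2⟩, y, ⟨hy0, hy1, hy2⟩, hxS, hyS, hreach⟩
    have hx : x = ![0, 0] := vec_eq_zero_zero hx0 (by omega)
    rw [SimpleGraph.reachable_iff_reflTransGen] at hreach
    rcases hreach.cases_head with heq | ⟨w, hadj, -⟩
    · have := congrArg Subtype.val heq
      simp only at this
      rw [this] at hx0
      push_cast at hy0
      omega
    · rw [SimpleGraph.induce_adj, openGraph_adj] at hadj
      obtain ⟨hmem, hne⟩ := hadj
      have hw := w.2
      simp only [Set.mem_setOf_eq] at hw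
      obtain ⟨hw0, hw1, hw2, hw3⟩ := hw
      have hw' : (w : Site 2) = ![1, 0] := by
        refine vec_eq_one_zero ?_ (by omega)
        rcases (show (w : Site 2) 0 = 0 ∨ (w : Site 2) 0 = 1 by push_cast at hw1; omega) with h | h
        · exact absurd ((hx.trans (vec_eq_zero_zero h (by omega)).symm)) hne
        · exact h
      simp only [edges, Set.mem_setOf_eq] at hmem
      obtain ⟨u, v, huv, hu, hv, -⟩ := hmem
      rw [hx, hw', Sym2.eq_iff] at huv
      rcases huv with ⟨rfl, rfl⟩ | ⟨rfl, rfl⟩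
      · exact ⟨(blk_zero_zero S ω).1 hu, (blk_one_zero S ω).1 hv⟩
      · exact ⟨(blk_zero_zero S ω).1 hv, (blk_one_zero S ω).1 hu⟩
  · rintro ⟨h0, h1⟩
    refine ⟨![0, 0], ⟨by simp, by simp, by simp⟩, ![1, 0], ⟨by simp, by simp, by simp⟩,
      ⟨by simp, by simp, by simp, by simp⟩, ⟨by simp, by simp, by simp, by simp⟩, ?_⟩
    apply SimpleGraph.Adj.reachable
    rw [SimpleGraph.induce_adj, openGraph_adj]
    refine ⟨?_, ?_⟩
    · simp only [edges, Set.mem_setOf_eq]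
      exact ⟨![0, 0], ![1, 0], rfl, (blk_zero_zero S ω).2 h0, (blk_one_zero S ω).2 h1,
        Or.inl (by ext i; fin_cases i <;> simp)⟩
    · intro h
      have := congrFun h 0
      simp at this

/-- TIGHTNESS DATUM: the `2 × 1` box at the origin is crossed with probability exactly `1/4`,
for every column pattern `S`. -/
theorem pH_one_zero_zero (S : Set ℤ) : pH S 1 0 0 = 1 / 4 := by
  rw [pH, hEvent_one, μIK_real_F]

/-- Any constant admissible in the crux is at most `1/4` (so the crux is `∃ c ∈ (0, 1/4], …`). -/
theorem c_le_quarter {c : ℝ}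
    (h : ∀ S : Set ℤ, ∀ n : ℕ, 1 ≤ n → ∀ a b : ℤ, c ≤ pH S n a b ∧ c ≤ pV S n a b) : c ≤ 1 / 4 :=
  (pH_one_zero_zero ∅) ▸ (h ∅ 1 le_rfl 0 0).1

/-- The crux with any constant `c > 1/4` is FALSE (refuted strengthening). -/
theorem not_IKMixedBoxCrossing_with_large_constant {c : ℝ} (hc : 1 / 4 < c) :
    ¬ (∀ S : Set ℤ, ∀ n : ℕ, 1 ≤ n → ∀ a b : ℤ, c ≤ pH S n a b ∧ c ≤ pV S n a b) :=
  fun h => absurd (c_le_quarter h) (not_le.mpr hc)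

end

end Summit.CriticalPhenomena.CardyFormulaZ2.Theorems.IKMixedBoxCrossing.Negative
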